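import Literature.AlgebraicGeometry.Resolution.WeightedCentreLayerEquation
import HarnessLib

/-!
# Straightened coordinates: conjugating the substitution by the block shear (E1 §5.5, check (c))

Uniform value line: typed theorems in the polynomial weighted-centre model `W(f)` — NOT a
resolution theorem, NOT summit progress; AI review is weaker than expert review.

After the `V = 0` exit of the block step (`WeightedCentreOneRound`,
`IsBlockSubstitution.exists_straightening_of_injective`: polynomials `g_k` in the lower variables
with `ψ (X_k − g_k) = X_k − g_k` for every `k` in the block `B`) one passes to the STRAIGHTENED
coordinates `ỹ_k = y_k − g_k` (others unchanged).  On the polynomial ring this is the block shear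
`θ : X_k ↦ X_k + g_k (k ∈ B)`, an automorphism because no `g_k` involves a block variable, and the
substitution in the new coordinates is the conjugate `ψ̃ = θ ∘ ψ ∘ θ⁻¹`.  This file types:

* `blockShearHom`, `blockShear` — the block shear and its inverse `X_k ↦ X_k − g_k`; it fixes every
  polynomial without block variables (`blockShear_eq_self`), and is graded for every additive
  weight for which `g_k` is homogeneous of the weight of `X_k` (`isWeightedHomogeneous_blockShear`:
  e.g. the valuation weights — the new face polynomial `θ H` keeps its valuation).
* `coordConj θ ψ = θ ∘ ψ ∘ θ⁻¹` with `coordConj_face_equation`: `ψ H = H − c ⇒ ψ̃ (θ H) = θ H − c`.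
* `coordConj_blockShear_X_of_mem`: `ψ (X_k − g_k) = X_k − g_k ⇒ ψ̃ (X_k) = X_k` — **the straightened
  block is fixed**; `coordConj_blockShear_X_of_fix`: variables off the block fixed by `ψ` stay
  fixed; `coordConj_blockShear_X_of_free`: on a variable off the block whose image has no block
  variable, `ψ̃ = ψ`; `IsBlockSubstitution.coordConj_blockShear`: the block-substitution structure
  of a lower block is inherited by `ψ̃`.
* `coordConj_blockShear_invariant` — the induction invariant at the next block: `ψ̃` fixes every
  variable of `L ∪ B` (`L` = the blocks above, already fixed by `ψ`) and satisfies the face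
  equation for `θ H`.

References: [CossartJannsenSaito2020] Def. 8.2 / Thm. 8.16 (pp. 118–121: coordinate changes
`y ↦ y + q(u)`); [AbramovichTemkinWlodarczyk2024] Lemma 5.2.10 (p. 1577), §5.1 (p. 1575);
[HauserWagner2014] (T) translational move (arXiv p. 14–15).
-/

open MvPolynomial

namespace Literature.AlgebraicGeometry.Resolution.WeightedBlowup

variable {K : Type*} [Field K] {σ : Type*} [DecidableEq σ]

/-! ## §1 The block shear -/

/-- The algebra endomorphism `X_k ↦ X_k + g_k` for `k ∈ B`, every other variable fixed.
[cite: CossartJannsenSaito2020, Def. 8.2 / Thm. 8.16 (coordinate changes `y ↦ y + q(u)`)] -/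
noncomputable def blockShearHom (B : Finset σ) (g : σ → MvPolynomial σ K) :
    MvPolynomial σ K →ₐ[K] MvPolynomial σ K :=
  aeval fun i => if i ∈ B then X i + g i else X i

/-- (derived here) [cite: CossartJannsenSaito2020, Def. 8.2] -/
theorem blockShearHom_X_of_mem {B : Finset σ} (g : σ → MvPolynomial σ K) {k : σ} (hk : k ∈ B) :
    blockShearHom B g (X k) = X k + g k := by
  simp [blockShearHom, hk]

/-- (derived here) [cite: CossartJannsenSaito2020, Def. 8.2] -/
theorem blockShearHom_X_of_not_mem {B : Finset σ} (g : σ → MvPolynomial σ K) {i : σ} (hi : i ∉ B) :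
    blockShearHom B g (X i) = X i := by
  simp [blockShearHom, hi]

/-- A polynomial without block variables is fixed by the block shear (derived here).
[cite: CossartJannsenSaito2020, Def. 8.2] -/
theorem blockShearHom_eq_self {B : Finset σ} (g : σ → MvPolynomial σ K) {P : MvPolynomial σ K}
    (hP : ∀ i ∈ P.vars, i ∉ B) : blockShearHom B g P = P := by
  change (blockShearHom B g : MvPolynomial σ K →ₐ[K] MvPolynomial σ K).toRingHom P = RingHom.id _ P
  refine hom_congr_vars ?_ ?_ rfl
  · ext c
    simp [blockShearHom]
  · intro i hi _
    simp [blockShearHom, hP i hi]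

/-- `(X_k ↦ X_k − g_k) ∘ (X_k ↦ X_k + g_k) = id` when no `g_k` involves a block variable. [folklore] -/
private theorem blockShearHom_comp_neg {B : Finset σ} {g : σ → MvPolynomial σ K}
    (hg : ∀ k ∈ B, ∀ i ∈ (g k).vars, i ∉ B) :
    (blockShearHom B (-g)).comp (blockShearHom B g) = AlgHom.id K _ := by
  refine MvPolynomial.algHom_ext fun i => ?_
  by_cases hi : i ∈ B
  · rw [AlgHom.comp_apply, blockShearHom_X_of_mem g hi, map_add, blockShearHom_X_of_mem _ hi,
      blockShearHom_eq_self (-g) (hg i hi), AlgHom.id_apply, Pi.neg_apply]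
    ring
  · rw [AlgHom.comp_apply, blockShearHom_X_of_not_mem g hi, blockShearHom_X_of_not_mem _ hi,
      AlgHom.id_apply]

/-- **The block shear** `θ : X_k ↦ X_k + g_k (k ∈ B)`, an automorphism with inverse
`X_k ↦ X_k − g_k` as soon as no `g_k` involves a block variable (the passage to the straightened
coordinates `ỹ_B = y_B − g_B(y_>)`). [cite: CossartJannsenSaito2020, Def. 8.2 / Thm. 8.16]
[cite: AbramovichTemkinWlodarczyk2024, Lemma 5.2.10 (p. 1577)] -/
noncomputable def blockShear (B : Finset σ) (g : σ → MvPolynomial σ K)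
    (hg : ∀ k ∈ B, ∀ i ∈ (g k).vars, i ∉ B) : MvPolynomial σ K ≃ₐ[K] MvPolynomial σ K :=
  AlgEquiv.ofAlgHom (blockShearHom B g) (blockShearHom B (-g))
    (by
      have h := blockShearHom_comp_neg (B := B) (g := -g)
        (fun k hk i hi => hg k hk i (by rwa [Pi.neg_apply, vars_neg] at hi))
      rwa [neg_neg] at h)
    (blockShearHom_comp_neg hg)

section Shear

variable {B : Finset σ} {g : σ → MvPolynomial σ K} (hg : ∀ k ∈ B, ∀ i ∈ (g k).vars, i ∉ B)
include hg

/-- (derived here) [cite: CossartJannsenSaito2020, Def. 8.2] -/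
theorem blockShear_apply (P : MvPolynomial σ K) : blockShear B g hg P = blockShearHom B g P := rfl

/-- (derived here) [cite: CossartJannsenSaito2020, Def. 8.2] -/
theorem blockShear_symm_apply (P : MvPolynomial σ K) :
    (blockShear B g hg).symm P = blockShearHom B (-g) P := rfl

/-- (derived here) [cite: CossartJannsenSaito2020, Def. 8.2] -/
theorem blockShear_X_of_mem {k : σ} (hk : k ∈ B) : blockShear B g hg (X k) = X k + g k := by
  rw [blockShear_apply, blockShearHom_X_of_mem g hk]

/-- (derived here) [cite: CossartJannsenSaito2020, Def. 8.2] -/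
theorem blockShear_X_of_not_mem {i : σ} (hi : i ∉ B) : blockShear B g hg (X i) = X i := by
  rw [blockShear_apply, blockShearHom_X_of_not_mem g hi]

/-- The inverse shear: `θ⁻¹ (X_k) = X_k − g_k` (derived here). [cite: CossartJannsenSaito2020, Def. 8.2] -/
theorem blockShear_symm_X_of_mem {k : σ} (hk : k ∈ B) : (blockShear B g hg).symm (X k) = X k - g k := by
  rw [blockShear_symm_apply, blockShearHom_X_of_mem _ hk, Pi.neg_apply, sub_eq_add_neg]

/-- (derived here) [cite: CossartJannsenSaito2020, Def. 8.2] -/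
theorem blockShear_symm_X_of_not_mem {i : σ} (hi : i ∉ B) : (blockShear B g hg).symm (X i) = X i := by
  rw [blockShear_symm_apply, blockShearHom_X_of_not_mem _ hi]

/-- The shear fixes every polynomial without block variables (derived here).
[cite: CossartJannsenSaito2020, Def. 8.2] -/
theorem blockShear_eq_self {P : MvPolynomial σ K} (hP : ∀ i ∈ P.vars, i ∉ B) :
    blockShear B g hg P = P := by
  rw [blockShear_apply, blockShearHom_eq_self g hP]

/-- (derived here) [cite: CossartJannsenSaito2020, Def. 8.2] -/
theorem blockShear_symm_eq_self {P : MvPolynomial σ K} (hP : ∀ i ∈ P.vars, i ∉ B) :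
    (blockShear B g hg).symm P = P := by
  rw [blockShear_symm_apply, blockShearHom_eq_self (-g) hP]

end Shear

/-! ## §2 Gradedness of the shear -/

omit [DecidableEq σ] in
/-- Graded substitutions for an arbitrary additive weight monoid. [folklore] -/
private theorem isWeightedHomogeneous_aeval'' {M : Type*} [AddCommMonoid M] (w : σ → M)
    (θ : σ → MvPolynomial σ K) (hθ : ∀ i, IsWeightedHomogeneous w (θ i) (w i))
    {P : MvPolynomial σ K} {m : M} (hP : IsWeightedHomogeneous w P m) :
    IsWeightedHomogeneous w (aeval θ P) m := by
  classical
  have hexp : aeval θ P = ∑ d ∈ P.support, C (coeff d P) * ∏ i ∈ d.support, θ i ^ d i := by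
    rw [MvPolynomial.aeval_def, MvPolynomial.eval₂_eq]
    simp only [MvPolynomial.algebraMap_eq]
  rw [hexp]
  refine IsWeightedHomogeneous.sum _ _ _ fun d hd => ?_
  have hwd : Finsupp.weight w d = m := hP (MvPolynomial.mem_support_iff.mp hd)
  have hπ : IsWeightedHomogeneous w (∏ i ∈ d.support, θ i ^ d i) (∑ i ∈ d.support, d i • w i) :=
    IsWeightedHomogeneous.prod _ _ _ fun i _ => (hθ i).pow (d i)
  have hs : ∑ i ∈ d.support, d i • w i = m := by
    rw [← hwd, Finsupp.weight_apply, Finsupp.sum]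
  rw [hs] at hπ
  exact hπ.C_mul _

/-- `X_k ↦ X_k + g_k` is graded when each `g_k` is homogeneous of the weight of `X_k`. [folklore] -/
private theorem isWeightedHomogeneous_blockShearHom {M : Type*} [AddCommMonoid M] (w : σ → M)
    {B : Finset σ} {g : σ → MvPolynomial σ K} (hgw : ∀ k ∈ B, IsWeightedHomogeneous w (g k) (w k))
    {P : MvPolynomial σ K} {n : M} (hP : IsWeightedHomogeneous w P n) :
    IsWeightedHomogeneous w (blockShearHom B g P) n := by
  unfold blockShearHom
  refine isWeightedHomogeneous_aeval'' w _ (fun i => ?_) hP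
  split_ifs with hi
  · exact (isWeightedHomogeneous_X K w i).add (hgw i hi)
  · exact isWeightedHomogeneous_X K w i

/-- **The shear is graded** for every additive weight `w` with each `g_k` `w`-homogeneous of weight
`w k` (derived here) — for the valuation weights `γ` (each `g_k` quasi-homogeneous of weight
`γ_k = w_B`) this says the new face polynomial `θ H` has the same valuation on every monomial.
[cite: AbramovichTemkinWlodarczyk2024, Lemma 5.2.10 (p. 1577)] -/
theorem isWeightedHomogeneous_blockShear {M : Type*} [AddCommMonoid M] (w : σ → M)
    {B : Finset σ} {g : σ → MvPolynomial σ K} (hg : ∀ k ∈ B, ∀ i ∈ (g k).vars, i ∉ B)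
    (hgw : ∀ k ∈ B, IsWeightedHomogeneous w (g k) (w k))
    {P : MvPolynomial σ K} {n : M} (hP : IsWeightedHomogeneous w P n) :
    IsWeightedHomogeneous w (blockShear B g hg P) n := by
  rw [blockShear_apply]
  exact isWeightedHomogeneous_blockShearHom w hgw hP

/-- The inverse shear is graded too (derived here). [cite: AbramovichTemkinWlodarczyk2024, Lemma 5.2.10 (p. 1577)] -/
theorem isWeightedHomogeneous_blockShear_symm {M : Type*} [AddCommMonoid M] (w : σ → M)
    {B : Finset σ} {g : σ → MvPolynomial σ K} (hg : ∀ k ∈ B, ∀ i ∈ (g k).vars, i ∉ B)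
    (hgw : ∀ k ∈ B, IsWeightedHomogeneous w (g k) (w k))
    {P : MvPolynomial σ K} {n : M} (hP : IsWeightedHomogeneous w P n) :
    IsWeightedHomogeneous w ((blockShear B g hg).symm P) n := by
  rw [blockShear_symm_apply]
  refine isWeightedHomogeneous_blockShearHom w (fun k hk => ?_) hP
  have h1 := (isWeightedHomogeneous_C w (-1 : K)).mul (hgw k hk)
  rw [zero_add] at h1
  have h2 : (-g) k = C (-1 : K) * g k := by
    rw [Pi.neg_apply, map_neg, map_one, neg_one_mul]
  rw [h2]
  exact h1

/-! ## §3 Conjugation -/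

/-- The substitution in new coordinates: `coordConj θ ψ = θ ∘ ψ ∘ θ⁻¹` (if `h̃ = θ h` is the
function `h` written in the new coordinates, then `h̃ ∘ ψ̃ = θ (h ∘ ψ)`).
[cite: AbramovichTemkinWlodarczyk2024, §5.1 (p. 1575: changes of parameters)] -/
noncomputable def coordConj (θ : MvPolynomial σ K ≃ₐ[K] MvPolynomial σ K)
    (ψ : MvPolynomial σ K →ₐ[K] MvPolynomial σ K) : MvPolynomial σ K →ₐ[K] MvPolynomial σ K :=
  ((θ : MvPolynomial σ K →ₐ[K] MvPolynomial σ K).comp ψ).comp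
    (θ.symm : MvPolynomial σ K →ₐ[K] MvPolynomial σ K)

omit [DecidableEq σ] in
/-- (derived here) [cite: AbramovichTemkinWlodarczyk2024, §5.1 (p. 1575)] -/
theorem coordConj_apply (θ : MvPolynomial σ K ≃ₐ[K] MvPolynomial σ K)
    (ψ : MvPolynomial σ K →ₐ[K] MvPolynomial σ K) (P : MvPolynomial σ K) :
    coordConj θ ψ P = θ (ψ (θ.symm P)) := rfl

omit [DecidableEq σ] in
/-- [folklore] -/
private theorem algEquiv_C (θ : MvPolynomial σ K ≃ₐ[K] MvPolynomial σ K) (c : K) : θ (C c) = C c := by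
  rw [← MvPolynomial.algebraMap_eq]
  exact θ.commutes c

omit [DecidableEq σ] in
/-- **The face equation in new coordinates** (derived here): `ψ H = H − c ⇒ ψ̃ (θ H) = θ H − c`.
[cite: HauserWagner2014, (T) translational move (arXiv p. 14–15)] -/
theorem coordConj_face_equation (θ : MvPolynomial σ K ≃ₐ[K] MvPolynomial σ K)
    {ψ : MvPolynomial σ K →ₐ[K] MvPolynomial σ K} {H : MvPolynomial σ K} {c : K}
    (hQ : ψ H = H - C c) : coordConj θ ψ (θ H) = θ H - C c := by
  rw [coordConj_apply, AlgEquiv.symm_apply_apply, hQ, map_sub, algEquiv_C]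

omit [DecidableEq σ] in
/-- If `ψ` fixes `θ⁻¹ (X_i)` then `ψ̃` fixes `X_i` (derived here).
[cite: AbramovichTemkinWlodarczyk2024, §5.1 (p. 1575)] -/
theorem coordConj_X_of_fix (θ : MvPolynomial σ K ≃ₐ[K] MvPolynomial σ K)
    {ψ : MvPolynomial σ K →ₐ[K] MvPolynomial σ K} {i : σ} (h : ψ (θ.symm (X i)) = θ.symm (X i)) :
    coordConj θ ψ (X i) = X i := by
  rw [coordConj_apply, h, AlgEquiv.apply_symm_apply]

omit [DecidableEq σ] in
/-- If `θ⁻¹` fixes `P` and `θ` fixes `ψ P` then `ψ̃ P = ψ P` (derived here).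
[cite: AbramovichTemkinWlodarczyk2024, §5.1 (p. 1575)] -/
theorem coordConj_eq_of_fix (θ : MvPolynomial σ K ≃ₐ[K] MvPolynomial σ K)
    {ψ : MvPolynomial σ K →ₐ[K] MvPolynomial σ K} {P : MvPolynomial σ K} (h1 : θ.symm P = P)
    (h2 : θ (ψ P) = ψ P) : coordConj θ ψ P = ψ P := by
  rw [coordConj_apply, h1, h2]

/-! ## §4 The straightened substitution -/

section Straight

variable {B : Finset σ} {g : σ → MvPolynomial σ K} (hg : ∀ k ∈ B, ∀ i ∈ (g k).vars, i ∉ B)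
include hg

/-- **The straightened block is fixed** (derived here): after the `V = 0` exit,
`ψ (X_k − g_k) = X_k − g_k` gives `ψ̃ (X_k) = X_k` for the conjugate `ψ̃ = θ ∘ ψ ∘ θ⁻¹` by the
block shear. [cite: HauserWagner2014, (T) translational move (arXiv p. 14–15)]
[cite: AbramovichTemkinWlodarczyk2024, Lemma 5.2.10 (p. 1577)] -/
theorem coordConj_blockShear_X_of_mem {ψ : MvPolynomial σ K →ₐ[K] MvPolynomial σ K} {k : σ}
    (hk : k ∈ B) (hfix : ψ (X k - g k) = X k - g k) :
    coordConj (blockShear B g hg) ψ (X k) = X k :=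
  coordConj_X_of_fix _ (by rw [blockShear_symm_X_of_mem hg hk]; exact hfix)

/-- Variables off the block fixed by `ψ` stay fixed (derived here).
[cite: AbramovichTemkinWlodarczyk2024, §5.1 (p. 1575)] -/
theorem coordConj_blockShear_X_of_fix {ψ : MvPolynomial σ K →ₐ[K] MvPolynomial σ K} {i : σ}
    (hi : i ∉ B) (hfix : ψ (X i) = X i) : coordConj (blockShear B g hg) ψ (X i) = X i :=
  coordConj_X_of_fix _ (by rw [blockShear_symm_X_of_not_mem hg hi]; exact hfix)

/-- On a variable off the block whose image has no block variable, `ψ̃ = ψ` (derived here: the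
lower variables). [cite: AbramovichTemkinWlodarczyk2024, §5.1 (p. 1575)] -/
theorem coordConj_blockShear_X_of_free {ψ : MvPolynomial σ K →ₐ[K] MvPolynomial σ K} {i : σ}
    (hi : i ∉ B) (hfree : ∀ j ∈ (ψ (X i)).vars, j ∉ B) :
    coordConj (blockShear B g hg) ψ (X i) = ψ (X i) :=
  coordConj_eq_of_fix _ (blockShear_symm_X_of_not_mem hg hi) (blockShear_eq_self hg hfree)

/-- **The block-substitution structure of a lower block is inherited** (derived here): if `ψ` is
a block substitution for a block `B'` disjoint from `B` with shifts free of `B`, takes `B`-free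
values off `B`, and fixes the straightened block, then `ψ̃` is a block substitution for `B'` with
the same shifts. [cite: HauserWagner2014, (T) translational move (arXiv p. 14–15)] -/
theorem IsBlockSubstitution.coordConj_blockShear {B' : Finset σ}
    {ψ : MvPolynomial σ K →ₐ[K] MvPolynomial σ K} {S' : σ → MvPolynomial σ K}
    (hψ' : IsBlockSubstitution B' ψ S') (hB'B : ∀ k ∈ B', k ∉ B)
    (hS' : ∀ k ∈ B', ∀ i ∈ (S' k).vars, i ∉ B)
    (hψB : ∀ i ∉ B, ∀ j ∈ (ψ (X i)).vars, j ∉ B)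
    (hfixB : ∀ k ∈ B, ψ (X k - g k) = X k - g k) :
    IsBlockSubstitution B' (coordConj (blockShear B g hg) ψ) S' where
  map_X_of_mem k hk := by
    have hfree : ∀ j ∈ (ψ (X k)).vars, j ∉ B := by
      rw [hψ'.map_X_of_mem k hk]
      intro j hj
      rcases Finset.mem_union.mp (vars_add_subset _ _ hj) with h | h
      · rw [vars_X, Finset.mem_singleton] at h
        rw [h]
        exact hB'B k hk
      · exact hS' k hk j h
    rw [coordConj_blockShear_X_of_free hg (hB'B k hk) hfree, hψ'.map_X_of_mem k hk]
  shift_free := hψ'.shift_free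
  map_X_free i hi := by
    by_cases hiB : i ∈ B
    · rw [coordConj_blockShear_X_of_mem hg hiB (hfixB i hiB)]
      have h1 := isWeightedHomogeneous_X K (blockWeight B') i
      rwa [blockWeight_of_not_mem hi] at h1
    · rw [coordConj_blockShear_X_of_free hg hiB (hψB i hiB)]
      exact hψ'.map_X_free i hi

/-- **Induction invariant at the next block** (E1's check (c), derived here): if `ψ` fixes the
variables of the higher blocks `L`, fixes `X_k − g_k` on the block `B`, and
satisfies the face equation `ψ H = H − c`, then in the straightened coordinates `ψ̃` fixes every
variable of `L ∪ B` and satisfies the face equation for the new face polynomial `θ H`.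
[cite: HauserWagner2014, (T) translational move (arXiv p. 14–15)]
[cite: AbramovichTemkinWlodarczyk2024, Lemma 5.2.10 (p. 1577) and §5.1 (p. 1575)] -/
theorem coordConj_blockShear_invariant {L : Finset σ}
    {ψ : MvPolynomial σ K →ₐ[K] MvPolynomial σ K} (hfixL : ∀ i ∈ L, ψ (X i) = X i)
    (hfixB : ∀ k ∈ B, ψ (X k - g k) = X k - g k) {H : MvPolynomial σ K} {c : K}
    (hQ : ψ H = H - C c) :
    (∀ i ∈ L ∪ B, coordConj (blockShear B g hg) ψ (X i) = X i) ∧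
      coordConj (blockShear B g hg) ψ (blockShear B g hg H) = blockShear B g hg H - C c := by
  refine ⟨fun i hi => ?_, coordConj_face_equation _ hQ⟩
  by_cases hiB : i ∈ B
  · exact coordConj_blockShear_X_of_mem hg hiB (hfixB i hiB)
  · rcases Finset.mem_union.mp hi with h | h
    · exact coordConj_blockShear_X_of_fix hg hiB (hfixL i h)
    · exact absurd h hiB

end Straight

/-! ## §5 A worked instance -/

section Instance

/-- [folklore] -/
private noncomputable def gex : Fin 2 → MvPolynomial (Fin 2) K := fun _ => X 1 ^ 2

/-- [folklore] -/
private theorem gex_free : ∀ k ∈ ({0} : Finset (Fin 2)), ∀ i ∈ ((gex : Fin 2 → MvPolynomial (Fin 2) K) k).vars,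
    i ∉ ({0} : Finset (Fin 2)) := by
  intro k _ i hi
  have h := vars_pow (X 1 : MvPolynomial (Fin 2) K) 2 hi
  rw [vars_X, Finset.mem_singleton] at h
  rw [h]
  decide

/-- `ψ : X₀ ↦ X₀ + 2X₁ + 1, X₁ ↦ X₁ + 1` (so that `ψ (X₀ − X₁²) = X₀ − X₁²`). [folklore] -/
private noncomputable def ψex : MvPolynomial (Fin 2) K →ₐ[K] MvPolynomial (Fin 2) K :=
  aeval ![X 0 + 2 * X 1 + 1, X 1 + 1]

/-- Block `B = {0}`, `g₀ = X₁²`, `ψ` as above fixes `X₀ − X₁²`; in the straightened coordinates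
(`θ : X₀ ↦ X₀ + X₁²`) the conjugate substitution fixes `X₀` — by the theorem, and its value on the
lower variable is unchanged: `ψ̃ (X₁) = X₁ + 1`. [folklore] -/
example : coordConj (blockShear {0} gex gex_free) (ψex (K := K)) (X 0) = X 0 ∧
    coordConj (blockShear {0} gex gex_free) (ψex (K := K)) (X 1) = X 1 + 1 := by
  have hfix : ψex (K := K) (X 0 - gex 0) = X 0 - gex 0 := by
    simp only [ψex, gex, map_sub, map_pow, aeval_X, Matrix.cons_val_zero, Matrix.cons_val_one]
    ring
  refine ⟨coordConj_blockShear_X_of_mem gex_free (Finset.mem_singleton_self _) hfix, ?_⟩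
  have h1 : ψex (K := K) (X 1) = X 1 + 1 := by
    simp only [ψex, aeval_X, Matrix.cons_val_one, Matrix.cons_val_zero]
  rw [coordConj_blockShear_X_of_free gex_free (by decide) ?_, h1]
  rw [h1]
  intro j hj
  rcases Finset.mem_union.mp (vars_add_subset _ _ hj) with h | h
  · rw [vars_X, Finset.mem_singleton] at h
    rw [h]
    decide
  · rw [vars_one] at h
    exact absurd h (Finset.notMem_empty _)

end Instance

end Literature.AlgebraicGeometry.Resolution.WeightedBlowup
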